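import Literature.AlgebraicGeometry.Frobenioids.PrimesEquivWeak
import Literature.AlgebraicGeometry.Frobenioids.PrimaryStepsCompleteWeak
import HarnessLib

/-!
# Frobenioids I, Theorem 4.2 (i)/(ii), perfect-type case: transport of primary steps through an object
# and the unique family `Ψ^Prime`, for WEAKLY perf-factorial divisor monoids — weak twins of
# `PrimaryStepsTransport.lean` (two statements) and of `PrimesEquivalence.existsUnique_primesEquiv_family`

Mochizuki, *The geometry of Frobenioids I: the general theory*, Kyushu J. Math. **62** (2008)
293–400, §4, Theorem 4.2 (i)(ii) p. 77, proof pp. 78–80 ("`Ψ` maps primary steps to or from `A₁` to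
primary steps to or from `A₂`", p. 78; "`Ψ` induces a bijection `Ψ^Prime : Prime(Φ₁(A₁)) ⥲ Prime(Φ₂(A₂))`",
p. 80) [cite: MochizukiFrdI2008, Thm. 4.2 (i) p.77]; Proposition 4.1 (ii) p. 75.

PROOF-ONLY weak twins (seat abc-iut-L1-t14's statements, proofs VERBATIM) with the §4 standing hypothesis
"`Φ_i` perf-factorial" (Def. 2.4 (i) (a)–(d) as printed) REPLACED by the named weakening `IsPerfFactorialWeak`
of `PerfFactorialWeak.lean` ((a)–(c) verbatim + (d_ord), (d_res); cell finding F-L2d2-1: (d) fails for the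
divisor monoids of the tempered Frobenioids of [EtTh] §3–§5, where [EtTh] Cor. 3.8 (iii) / Prop. 5.3 invoke
[FrdI] Thm. 4.9). Inputs BY NAME: `PreFrobenioid.isPrimaryPreStep_comp_iff_of_isStep_weak`
(`PrimaryStepsCompleteWeak.lean`), `PreFrobenioid.existsUnique_primesEquiv_weak` (`PrimesEquivWeak.lean`, seat
abc-iut-L1-t12), `IsPerfFactorialWeak.isPrimary_mul_iff_exists_common_prime` (`PrimaryDvdTotalWeak.lean`), and
the hypothesis-free transport lemmas of `PrimaryStepsTransport.lean` / `PrimesEquivalence.lean`; (d) itself is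
never used. Names = strong names + `_weak`. The printed (strong) case is recovered through
`IsPerfFactorial.weak`. Cell abc-iut, layer L1, seat abc-iut-L1-t11 (block T1 of the [FrdI] Thm. 4.9 /
Cor. 4.11 (iii)(iv) weak programme, split with seat abc-iut-L1-t14; consumers: the weak twins of the
`T42.Setting` spine — `Thm42SubProofsII`, `DivisorMonoidIsoDivFrobTrivial`, `Thm49RightEqLeftAssembly`). No new
definitions; nothing printed is restated as if corrected; nothing here bears on [IUTchIII] Cor. 3.12.

* `PreFrobenioid.isPrimaryPreStep_comp_map_weak` — Thm. 4.2 (i), primary composites through an object;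
* `PreFrobenioid.isPrimaryPreStep_map_of_from_weak` — Thm. 4.2 (i), primary steps out of an object;
* `PreFrobenioid.existsUnique_primesEquiv_family_weak` — Thm. 4.2 (ii), the unique family
  `e_A : Prime(Φ₁(A)) ≃ Prime(Φ₂(ΨA))` with its clauses (a), (b).
-/

namespace Literature.AlgebraicGeometry.Frobenioids

open CategoryTheory Opposite

namespace PreFrobenioid

universe w v v' u u' w₂ v₂ v₂' u₂ u₂'

variable {D : Type u} [Category.{v} D] {Φ : Dᵒᵖ ⥤ CommMonCat.{w}}
  {C : Type u'} [Category.{v'} C] {F : C ⥤ ElemFrobenioid Φ}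

variable {D₂ : Type u₂} [Category.{v₂} D₂] {Φ₂ : D₂ᵒᵖ ⥤ CommMonCat.{w₂}}
  {C₂ : Type u₂'} [Category.{v₂'} C₂] {F₂ : C₂ ⥤ ElemFrobenioid Φ₂} (Ψ : C ≌ C₂)

set_option backward.isDefEq.respectTransparency false in
/-- **Theorem 4.2 (i), primary composites through an object, perfect-type case** (FrdI p. 78: "primary
steps `B₁ → A₁`, `A₁ → C₁` with primary composite `B₁ → C₁` are mapped to primary steps `B₂ → A₂`,
`A₂ → C₂` with primary composite", via Prop. 4.1 (ii)): for Frobenioids of perfect and isotropic type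
with WEAKLY perf-factorial divisor monoids, an equivalence `Ψ` preserving steps and pre-steps with `Ψ⁻¹`
preserving steps [Thm. 3.4 (ii)], and an object `A` such that `Ψ` preserves the primary steps INTO `A`
— HYPOTHESES — if `φ : B → A` is a primary step and `ψ : A → C` a step with `ψ ∘ φ` and `ψ` primary,
then `Ψ(ψ) ∘ Ψ(φ)` and `Ψ(ψ)` are primary (Prop. 4.1 (ii) in `C₁`, transport of its step-factorisation
condition, Prop. 4.1 (ii) in `C₂`). [cite: MochizukiFrdI2008, Thm. 4.2 (i) p.77] -/
theorem isPrimaryPreStep_comp_map_weak (hF : IsFrobenioid F) (hF₂ : IsFrobenioid F₂)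
    (hperf : IsOfPerfectType F) (hperf₂ : IsOfPerfectType F₂)
    (histr : IsOfIsotropicType F) (histr₂ : IsOfIsotropicType F₂)
    (hpf : Objectwise (fun M _ => IsPerfFactorialWeak M) Φ)
    (hpf₂ : Objectwise (fun M _ => IsPerfFactorialWeak M) Φ₂)
    (hstep : ∀ ⦃X Y : C⦄ (φ : X ⟶ Y), IsStep F φ → IsStep F₂ (Ψ.functor.map φ))
    (hstep' : ∀ ⦃X Y : C₂⦄ (φ : X ⟶ Y), IsStep F₂ φ → IsStep F (Ψ.inverse.map φ))
    (hpre : ∀ ⦃X Y : C⦄ (φ : X ⟶ Y), IsPreStep F φ → IsPreStep F₂ (Ψ.functor.map φ))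
    {A : C}
    (hprimA : ∀ ⦃E : C⦄ (ε : E ⟶ A), IsStep F ε → IsPrimaryPreStep F ε →
      IsPrimaryPreStep F₂ (Ψ.functor.map ε))
    {B C' : C} {φ : B ⟶ A} {ψ : A ⟶ C'} (hφ : IsStep F φ) (hφp : IsPrimaryPreStep F φ)
    (hψ : IsStep F ψ) (hcomp : IsPrimaryPreStep F (φ ≫ ψ)) (hψp : IsPrimaryPreStep F ψ) :
    IsPrimaryPreStep F₂ (Ψ.functor.map φ ≫ Ψ.functor.map ψ) ∧ IsPrimaryPreStep F₂ (Ψ.functor.map ψ) := by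
  have h1 := (isPrimaryPreStep_comp_iff_of_isStep_weak hF hperf histr hpf hφ hφp hψ).mp ⟨hcomp, hψp⟩
  refine (isPrimaryPreStep_comp_iff_of_isStep_weak hF₂ hperf₂ histr₂ hpf₂ (hstep φ hφ) (hprimA φ hφ hφp)
    (hstep ψ hψ)).mpr ?_
  intro A' φ' ψ' hφ' hψ' hfac
  -- pull the factorisation `ψ' ∘ φ' = Ψ(ψ ∘ φ)` back to `C`
  have hcm : Ψ.inverse.map φ' ≫ Ψ.inverse.map ψ' = Ψ.unitInv.app B ≫ (φ ≫ ψ) ≫ Ψ.unit.app C' := by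
    rw [← Functor.map_comp, hfac, ← Functor.map_comp, Ψ.inv_fun_map]
  obtain ⟨A'', φ'', ζ, ζ', hφ'', hζ, hζ', e₁, e₂⟩ := h1 (Ψ.unit.app B ≫ Ψ.inverse.map φ')
    (Ψ.inverse.map ψ' ≫ Ψ.unitInv.app C') ((hstep' φ' hφ').iso_comp (Ψ.unit.app B))
    ((hstep' ψ' hψ').comp_iso (Ψ.unitInv.app C')) (by simp [reassoc_of% hcm])
  -- and push the witnesses forward
  refine ⟨Ψ.functor.obj A'', Ψ.functor.map φ'', Ψ.functor.map ζ, Ψ.functor.map ζ' ≫ Ψ.counit.app A',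
    hstep φ'' hφ'', hpre ζ hζ, IsPreStep.comp F₂ (hpre ζ' hζ') (isPreStep_of_isIso F₂ _),
    by rw [← Functor.map_comp, e₁], ?_⟩
  rw [← Ψ.functor.map_comp_assoc, e₂, Functor.map_comp, Ψ.fun_inv_map]
  simp

/-- **Theorem 4.2 (i), primary steps out of an object, perfect-type case** (FrdI p. 78: "`Ψ` maps
primary steps to or from `A₁` to primary steps to or from `A₂`"): under the hypotheses of
`isPrimaryPreStep_comp_map_weak`, every primary step `ψ : A → C` maps to a primary step `Ψ(ψ)`. Proof:
choose (Def. 1.3 (iii)(d)) a primary step `φ : B → A` with `x_φ = Div(ψ)`, so that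
`Div(ψ ∘ φ) = φ^*(2·Div ψ)` is primary, and apply `isPrimaryPreStep_comp_map_weak`.
[cite: MochizukiFrdI2008, Thm. 4.2 (i) p.77] -/
theorem isPrimaryPreStep_map_of_from_weak (hF : IsFrobenioid F) (hF₂ : IsFrobenioid F₂)
    (hperf : IsOfPerfectType F) (hperf₂ : IsOfPerfectType F₂)
    (histr : IsOfIsotropicType F) (histr₂ : IsOfIsotropicType F₂)
    (hpf : Objectwise (fun M _ => IsPerfFactorialWeak M) Φ)
    (hpf₂ : Objectwise (fun M _ => IsPerfFactorialWeak M) Φ₂)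
    (hstep : ∀ ⦃X Y : C⦄ (φ : X ⟶ Y), IsStep F φ → IsStep F₂ (Ψ.functor.map φ))
    (hstep' : ∀ ⦃X Y : C₂⦄ (φ : X ⟶ Y), IsStep F₂ φ → IsStep F (Ψ.inverse.map φ))
    (hpre : ∀ ⦃X Y : C⦄ (φ : X ⟶ Y), IsPreStep F φ → IsPreStep F₂ (Ψ.functor.map φ))
    {A : C}
    (hprimA : ∀ ⦃E : C⦄ (ε : E ⟶ A), IsStep F ε → IsPrimaryPreStep F ε →
      IsPrimaryPreStep F₂ (Ψ.functor.map ε))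
    {C' : C} {ψ : A ⟶ C'} (hψ : IsStep F ψ) (hψp : IsPrimaryPreStep F ψ) :
    IsPrimaryPreStep F₂ (Ψ.functor.map ψ) := by
  have hP := hF.isPreFrobenioid
  -- a primary step `φ : B → A` with `x_φ = Div ψ`
  obtain ⟨B, φ, hφco, hφx⟩ := hF.iii_d_over_surj A (Div F ψ)
  have hφp : IsPrimaryPreStep F φ := isPrimaryPreStep_of_isPrimary_invDiv hφco.2 (hφx ▸ hψp.2)
  have hφ : IsStep F φ := by
    refine ⟨hφco.2, fun h => hφp.2.1 ?_⟩
    exact isIsometry_of_isIso F hP φ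
  haveI : IsIso (Base F φ) := hφ.1.2
  have hcomp : IsPrimaryPreStep F (φ ≫ ψ) := by
    refine ⟨IsPreStep.comp F hφ.1 hψ.1, ?_⟩
    have hdφ : Div F φ = pull Φ (Base F φ) (Div F ψ) := by rw [← hφx, pull_invDiv]
    rw [div_comp_of_isLinear φ hψ.1.1, hdφ, ← map_mul, ← pow_two]
    exact (isPrimary_pull_iff (Base F φ) _).mpr
      (hψp.2.pow (hP.isDivisorial (baseObj F A)).isSharp two_pos)
  exact (isPrimaryPreStep_comp_map_weak Ψ hF hF₂ hperf hperf₂ histr histr₂ hpf hpf₂ hstep hstep' hpre hprimA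
    hφ hφp hψ hcomp hψp).2


/-! ### Theorem 4.2 (ii): the unique family `Ψ^Prime` (weak hypothesis) -/

set_option backward.isDefEq.respectTransparency false in
/-- **Theorem 4.2 (ii), perfect-type case, modulo (i)** (FrdI pp. 77–80): for Frobenioids of perfect and
isotropic type with WEAKLY perf-factorial divisor monoids and an equivalence `Ψ` such that `Ψ`, `Ψ⁻¹` preserve
steps, pre-steps and primary pre-steps (HYPOTHESES = Thm. 3.4 (ii), Thm. 4.2 (i)), there is a UNIQUE
family of bijections `e A : Prime(Φ₁(A)) ≃ Prime(Φ₂(Ψ A))` such that for every `𝔭 ∈ Prime(Φ₁(A))`: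
(a) for every co-angular pre-step `φ : A → B`, `Div(φ) ∈ Φ₁(A)_𝔭 ⟺ Div(Ψ φ) ∈ Φ₂(Ψ A)_{e A 𝔭}`;
(b) for every co-angular pre-step `ψ : B → A`, `ψ_*Div(ψ) ∈ Φ₁(A)_𝔭 ⟺ Ψ(ψ)_*Div(Ψ ψ) ∈ Φ₂(Ψ A)_{e A 𝔭}`
(both memberships written, as in the typed statement, through `Base(−)^*`).
[cite: MochizukiFrdI2008, Thm. 4.2 (ii) p.77] -/
theorem existsUnique_primesEquiv_family_weak (hF : IsFrobenioid F) (hF₂ : IsFrobenioid F₂)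
    (hperf : IsOfPerfectType F) (hperf₂ : IsOfPerfectType F₂)
    (histr : IsOfIsotropicType F) (histr₂ : IsOfIsotropicType F₂)
    (hpf : Objectwise (fun M _ => IsPerfFactorialWeak M) Φ)
    (hpf₂ : Objectwise (fun M _ => IsPerfFactorialWeak M) Φ₂)
    (hstep : ∀ ⦃X Y : C⦄ (φ : X ⟶ Y), IsStep F φ → IsStep F₂ (Ψ.functor.map φ))
    (hstep' : ∀ ⦃X Y : C₂⦄ (φ : X ⟶ Y), IsStep F₂ φ → IsStep F (Ψ.inverse.map φ))
    (hpre : ∀ ⦃X Y : C⦄ (φ : X ⟶ Y), IsPreStep F φ → IsPreStep F₂ (Ψ.functor.map φ))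
    (hpre' : ∀ ⦃X Y : C₂⦄ (φ : X ⟶ Y), IsPreStep F₂ φ → IsPreStep F (Ψ.inverse.map φ))
    (hprim : ∀ ⦃X Y : C⦄ (φ : X ⟶ Y), IsPrimaryPreStep F φ → IsPrimaryPreStep F₂ (Ψ.functor.map φ))
    (hprim' : ∀ ⦃X Y : C₂⦄ (φ : X ⟶ Y), IsPrimaryPreStep F₂ φ → IsPrimaryPreStep F (Ψ.inverse.map φ)) :
    ∃! e : ∀ A : C, Primes (Φ.obj (op (baseObj F A))) ≃ Primes (Φ₂.obj (op (baseObj F₂ (Ψ.functor.obj A)))),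
      ∀ (A : C) (𝔭 : Primes (Φ.obj (op (baseObj F A)))),
        (∀ ⦃B : C⦄ (φ : A ⟶ B), IsCoAngularPreStep F φ →
            (Div F φ ∈ 𝔭.submonoid ↔ Div F₂ (Ψ.functor.map φ) ∈ (e A 𝔭).submonoid)) ∧
        ∀ ⦃B : C⦄ (ψ : B ⟶ A), IsCoAngularPreStep F ψ →
          ((∃ y ∈ 𝔭.submonoid, pull Φ (Base F ψ) y = Div F ψ) ↔
            ∃ y ∈ (e A 𝔭).submonoid,
              pull Φ₂ (Base F₂ (Ψ.functor.map ψ)) y = Div F₂ (Ψ.functor.map ψ)) := by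
  have hP := hF.isPreFrobenioid
  have hP₂ := hF₂.isPreFrobenioid
  have H := fun A : C => existsUnique_primesEquiv_weak Ψ hF hF₂ histr histr₂ hpf hpf₂ hpre hpre' A
    (fun E ε hε => hprim ε hε) (fun Z ξ hξ => hprim' ξ hξ)
  choose e he using fun A => (H A).exists
  -- (b'): the characteristic property, for an arbitrary co-angular pre-step into `A`
  have clauseB : ∀ (A : C) (𝔭 : Primes (Φ.obj (op (baseObj F A)))) ⦃B : C⦄ (ψ : B ⟶ A),
      IsCoAngularPreStep F ψ →
        ((∃ y ∈ 𝔭.submonoid, pull Φ (Base F ψ) y = Div F ψ) ↔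
          ∃ y ∈ (e A 𝔭).submonoid,
            pull Φ₂ (Base F₂ (Ψ.functor.map ψ)) y = Div F₂ (Ψ.functor.map ψ)) := by
    intro A 𝔭 B ψ hψ
    haveI : IsIso (Base F ψ) := hψ.2.2
    have hΨψ : IsPreStep F₂ (Ψ.functor.map ψ) := hpre ψ hψ.2
    haveI : IsIso (Base F₂ (Ψ.functor.map ψ)) := hΨψ.2
    by_cases hiso : IsIso ψ
    · -- both sides hold with `y = 0`
      refine ⟨fun _ => ⟨1, one_mem _, ?_⟩, fun _ => ⟨1, one_mem _, ?_⟩⟩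
      · rw [map_one]; exact (isIsometry_of_isIso F₂ hP₂ (Ψ.functor.map ψ)).symm
      · rw [map_one]; exact (isIsometry_of_isIso F hP ψ).symm
    · have hst : IsStep F ψ := ⟨hψ.2, hiso⟩
      have hst₂ : IsStep F₂ (Ψ.functor.map ψ) := hstep ψ hst
      -- both sides say: `x_ψ` resp. `x_{Ψ ψ}` lies in the prime
      have hL : (∃ y ∈ 𝔭.submonoid, pull Φ (Base F ψ) y = Div F ψ) ↔
          invDiv F ψ hψ.2.2 ∈ 𝔭.carrier := by
        constructor
        · rintro ⟨y, hy, hyx⟩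
          have hy' : y = invDiv F ψ hψ.2.2 :=
            pull_injective_of_isIso Φ (Base F ψ) (by rw [hyx, pull_invDiv])
          rcases (𝔭.mem_submonoid_iff' y).mp hy with h1 | h1
          · exact absurd (by rw [← hyx, h1, map_one]) (div_ne_one_of_isStep histr hst)
          · exact hy' ▸ h1
        · exact fun h => ⟨_, Submonoid.subset_closure h, pull_invDiv ψ hψ.2.2⟩
      have hR : (∃ y ∈ (e A 𝔭).submonoid,
            pull Φ₂ (Base F₂ (Ψ.functor.map ψ)) y = Div F₂ (Ψ.functor.map ψ)) ↔
          invDiv F₂ (Ψ.functor.map ψ) hΨψ.2 ∈ (e A 𝔭).carrier := by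
        constructor
        · rintro ⟨y, hy, hyx⟩
          have hy' : y = invDiv F₂ (Ψ.functor.map ψ) hΨψ.2 :=
            pull_injective_of_isIso Φ₂ (Base F₂ (Ψ.functor.map ψ)) (by rw [hyx, pull_invDiv])
          rcases ((e A 𝔭).mem_submonoid_iff' y).mp hy with h1 | h1
          · exact absurd (by rw [← hyx, h1, map_one]) (div_ne_one_of_isStep histr₂ hst₂)
          · exact hy' ▸ h1
        · exact fun h => ⟨_, Submonoid.subset_closure h, pull_invDiv _ hΨψ.2⟩
      rw [hL, hR]
      constructor
      · intro h
        exact he A ψ (isPrimaryPreStep_of_isPrimary_invDiv hψ.2 h.1) 𝔭 h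
      · intro h
        have hprimψ : IsPrimaryPreStep F ψ :=
          isPrimaryPreStep_of_map Ψ hP hprim' (isPrimaryPreStep_of_isPrimary_invDiv hΨψ h.1)
        let 𝔮 : Primes (Φ.obj (op (baseObj F A))) := Quotient.mk _ ⟨_, isPrimary_invDiv hprimψ⟩
        have hq : invDiv F ψ hψ.2.2 ∈ 𝔮.carrier := mem_carrier_mk_of_isPrimary _
        have h2 := he A ψ hprimψ 𝔮 hq
        have h3 : e A 𝔮 = e A 𝔭 := Primes.eq_of_mem_carrier h2 h
        rwa [(e A).injective h3] at hq
  -- (a): co-angular pre-steps out of `A`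
  have clauseA : ∀ (A : C) (𝔭 : Primes (Φ.obj (op (baseObj F A)))) ⦃B : C⦄ (φ : A ⟶ B),
      IsCoAngularPreStep F φ →
        (Div F φ ∈ 𝔭.submonoid ↔ Div F₂ (Ψ.functor.map φ) ∈ (e A 𝔭).submonoid) := by
    intro A 𝔭 B φ hφ
    by_cases hiso : IsIso φ
    · rw [show Div F φ = 1 from isIsometry_of_isIso F hP φ,
        show Div F₂ (Ψ.functor.map φ) = 1 from isIsometry_of_isIso F₂ hP₂ _]
      exact ⟨fun _ => one_mem _, fun _ => one_mem _⟩
    have hst : IsStep F φ := ⟨hφ.2, hiso⟩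
    have hst₂ : IsStep F₂ (Ψ.functor.map φ) := hstep φ hst
    -- the forward implication, for every prime
    have fwd : ∀ 𝔮 : Primes (Φ.obj (op (baseObj F A))), Div F φ ∈ 𝔮.carrier →
        Div F₂ (Ψ.functor.map φ) ∈ (e A 𝔮).carrier := by
      intro 𝔮 hφ𝔮
      have hφp : IsPrimaryPreStep F φ := ⟨hφ.2, hφ𝔮.1⟩
      -- a primary step `ε : E → A` in the prime `𝔮`; then `φ ∘ ε` is primary
      obtain ⟨E, ε, hε, hε𝔮⟩ := exists_isPrimaryPreStep_invDiv_mem hF A 𝔮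
      haveI : IsIso (Base F ε) := hε.1.2
      have hεst : IsStep F ε := hε.isStep hP
      have hcomp : IsPrimaryPreStep F (ε ≫ φ) := by
        refine ⟨IsPreStep.comp F hε.1 hφ.2, ?_⟩
        rw [div_comp_of_isLinear ε hφ.2.1, ← pull_invDiv ε hε.1.2, ← map_mul]
        exact (isPrimary_pull_iff (Base F ε) _).mpr
          (((hpf _).isPrimary_mul_iff_exists_common_prime hφ𝔮.1 hε𝔮.1).mpr ⟨𝔮, hφ𝔮, hε𝔮⟩)
      obtain ⟨hc₂, hφ₂⟩ := isPrimaryPreStep_comp_map_weak Ψ hF hF₂ hperf hperf₂ histr histr₂ hpf hpf₂ hstep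
        hstep' hpre (fun E' ε' _ hε' => hprim ε' hε') hεst hε hst hcomp hφp
      -- read off the prime of `Div(Ψ φ)` from the primary composite
      have hΨε : IsPrimaryPreStep F₂ (Ψ.functor.map ε) := hprim ε hε
      haveI : IsIso (Base F₂ (Ψ.functor.map ε)) := hΨε.1.2
      have hprod : IsPrimary (Div F₂ (Ψ.functor.map φ) * invDiv F₂ (Ψ.functor.map ε) hΨε.1.2) := by
        have h1 := hc₂.2
        rw [div_comp_of_isLinear (Ψ.functor.map ε) hφ₂.1.1, ← pull_invDiv (Ψ.functor.map ε) hΨε.1.2,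
          ← map_mul] at h1
        exact (isPrimary_pull_iff (Base F₂ (Ψ.functor.map ε)) _).mp h1
      obtain ⟨𝔮₂, hφ𝔮₂, hε𝔮₂⟩ := ((hpf₂ _).isPrimary_mul_iff_exists_common_prime hφ₂.2
        (isPrimary_invDiv hΨε)).mp hprod
      have hε' := he A ε hε 𝔮 hε𝔮
      rwa [Primes.eq_of_mem_carrier hε𝔮₂ hε'] at hφ𝔮₂
    constructor
    · intro h
      rcases (𝔭.mem_submonoid_iff' _).mp h with h1 | h1
      · exact absurd h1 (div_ne_one_of_isStep histr hst)
      · exact Submonoid.subset_closure (fwd 𝔭 h1)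
    · intro h
      rcases ((e A 𝔭).mem_submonoid_iff' _).mp h with h1 | h1
      · exact absurd h1 (div_ne_one_of_isStep histr₂ hst₂)
      · have hφp : IsPrimaryPreStep F φ := isPrimaryPreStep_of_map Ψ hP hprim' ⟨hpre φ hφ.2, h1.1⟩
        let 𝔮 : Primes (Φ.obj (op (baseObj F A))) := Quotient.mk _ ⟨_, hφp.2⟩
        have hq : Div F φ ∈ 𝔮.carrier := mem_carrier_mk_of_isPrimary _
        have h3 : e A 𝔮 = e A 𝔭 := Primes.eq_of_mem_carrier (fwd 𝔮 hq) h1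
        rw [(e A).injective h3] at hq
        exact Submonoid.subset_closure hq
  refine ⟨e, fun A 𝔭 => ⟨clauseA A 𝔭, clauseB A 𝔭⟩, ?_⟩
  -- uniqueness: clause (b) on primary steps into `A` pins down `e A`
  intro e' he'
  funext A
  refine (H A).unique ?_ (he A)
  intro E ε hε 𝔭 hε𝔭
  haveI : IsIso (Base F ε) := hε.1.2
  have hΨε := hprim ε hε
  haveI : IsIso (Base F₂ (Ψ.functor.map ε)) := hΨε.1.2
  have hco : IsCoAngularPreStep F ε :=
    ⟨isCoAngular_of_isIsotropic_codomains F ε fun Z _ => histr Z, hε.1⟩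
  obtain ⟨y, hy, hyx⟩ := ((he' A 𝔭).2 ε hco).mp ⟨_, Submonoid.subset_closure hε𝔭, pull_invDiv ε hε.1.2⟩
  have hy' : y = invDiv F₂ (Ψ.functor.map ε) hΨε.1.2 :=
    pull_injective_of_isIso Φ₂ (Base F₂ (Ψ.functor.map ε)) (by rw [hyx, pull_invDiv])
  rcases ((e' A 𝔭).mem_submonoid_iff' y).mp hy with h1 | h1
  · exact absurd (by rw [← hyx, h1, map_one])
      (div_ne_one_of_isStep histr₂ (hstep ε (hε.isStep hP)))
  · exact hy' ▸ h1

end PreFrobenioid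

end Literature.AlgebraicGeometry.Frobenioids
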